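import Literature.Computability.Cryptography.VonNeumannPredictor
import Literature.Computability.MetaComplexity.TruthTables
import Mathlib.Algebra.Order.Ring.Pow
import HarnessLib

/-!
# The amplified function `AMP_p(f) = E^{vN} ∘ ((f^k)^{GL_p})^{2T}` on bit positions (CIKK Thm. 4.8)

Groundwork for the named fact `Literature.Computability.Learning.cikk_learn_AC0Mod` (CIKK 2016,
Cor. 5.4), odd primes. CIKK §4.2 defines the amplifier of `AC⁰[p]` as the composition of the
direct product `f^k`, the Goldreich–Levin code over `𝔽_p` and von Neumann's trick; the NW
generator needs it as a BOOLEAN function on BIT strings, which CIKK leave implicit. This file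
fixes the encoding and proves the bridge to the ideal model of `VonNeumannPredictor.lean`:

* `AmpPIdx n k β T`, `Blk`, `blkOf`, `ampPEquiv` — an input consists of `2T` blocks, each of `k`
  points `xᵢ ∈ {0,1}ⁿ` and `k` positions `r̃ᵢ ∈ {0,1}^β`, read as the field element
  `rᵢ = (Σ_e r̃ᵢ(e) 2^e) mod p` (`posVal`); `blkG p f` is `Σᵢ rᵢ f(xᵢ) ∈ 𝔽_p` and
  **`ampP p f k β T = E^{vN}(blkG(block₁), …, blkG(block_{2T}))`**;
* the ideal blocks `SBlk n k p β = (Fin k → UJ n p β) × 𝔽_pᵏ` with `UJ n p β = {0,1}ⁿ × Fin B`,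
  `B = ⌊2^β/p⌋` (the quotient "junk" of a valid position travels with the point), their encoding
  `encBlk`/`encode` as VALID bit blocks (position value `< Bp`), `blkG_encBlk`:
  `blkG ∘ encBlk = dpGLP f'` for `f' = f ∘ fst`, and `ampP_encode`;
* `card_agree_encode_ge` — the agreement of a predictor with `AMP_p(f)` transfers to the ideal
  model up to the number of invalid inputs, `card_ideal_ge` — the valid inputs are a
  `≥ 1 - 2Tkp/2^β` fraction (Bernoulli), and **`ideal_agreement_ge`** — agreement `1/2 + η₀` with
  `AMP_p(f)` gives agreement `1/2 + (η₀ - 2ν)` in the ideal model (`ν = 2Tkp/2^β ≤ 1/2`), the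
  hypothesis of `vnPred_count`.

## References

* M. Carmosino, R. Impagliazzo, V. Kabanets, A. Kolokolova, *Learning algorithms from natural
  proofs*, CCC 2016, §4.2, Def. 4.5, Thm. 4.8, footnote 5 (sampling `ℤ_p` from bits)
  [CarmosinoImpagliazzoKabanetsKolokolova2016].
-/

namespace Literature.Computability.Learning

open Finset Matrix Function Literature.Computability.Cryptography Literature.Computability.MetaComplexity

variable {p : ℕ} [hp : Fact p.Prime] {n k β T : ℕ}

/-! ### The amplified function on bit positions -/

/-- Bit positions of an input of `AMP_p(f)`: block `c < 2T`, then either bit `j` of point `i` or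
bit `e` of position `i`. [cite: CarmosinoImpagliazzoKabanetsKolokolova2016, §4.2 (domain `D = {0,1}^m × F^k`, `(D²)^t`)] -/
abbrev AmpPIdx (n k β T : ℕ) : Type := Fin (T * 2) × ((Fin k × Fin n) ⊕ (Fin k × Fin β))

/-- One block: `k` points and `k` positions in bits. [cite: CarmosinoImpagliazzoKabanetsKolokolova2016, §4.2] -/
abbrev Blk (n k β : ℕ) : Type := (Fin k → (Fin n → Bool)) × (Fin k → (Fin β → Bool))

/-- The `c`-th block of an input. [folklore] -/
def blkOf (w : AmpPIdx n k β T → Bool) (c : Fin (T * 2)) : Blk n k β :=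
  (fun i j => w (c, Sum.inl (i, j)), fun i e => w (c, Sum.inr (i, e)))

/-- Inputs as tuples of blocks. [folklore] -/
def ampPEquiv (n k β T : ℕ) : (AmpPIdx n k β T → Bool) ≃ (Fin (T * 2) → Blk n k β) where
  toFun w := blkOf w
  invFun b := fun q => match q with
    | (c, Sum.inl (i, j)) => (b c).1 i j
    | (c, Sum.inr (i, e)) => (b c).2 i e
  left_inv w := by
    funext q
    rcases q with ⟨c, ⟨i, j⟩ | ⟨i, e⟩⟩ <;> rfl
  right_inv b := by
    funext c
    rfl

omit hp in
/-- `ampPEquiv` is `blkOf`. [folklore] -/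
@[simp] theorem ampPEquiv_apply (w : AmpPIdx n k β T → Bool) : ampPEquiv n k β T w = blkOf w := rfl

/-- The value `Σ_e r̃(e) 2^e` of a position (least significant bit first, the order of
`boolFunEquivFin`). [cite: CarmosinoImpagliazzoKabanetsKolokolova2016, footnote 5] -/
def posVal (y : Fin β → Bool) : ℕ := (boolFunEquivFin β y : ℕ)

omit hp in
/-- A position value is below `2^β`. [folklore] -/
theorem posVal_lt (y : Fin β → Bool) : posVal y < 2 ^ β := (boolFunEquivFin β y).isLt

variable (p) in
/-- The `𝔽_p`-Goldreich–Levin symbol of a block: `Σᵢ rᵢ f(xᵢ)` with `rᵢ = posVal(r̃ᵢ) mod p`.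
[cite: CarmosinoImpagliazzoKabanetsKolokolova2016, §4.2 ("apply the Goldreich-Levin construction `g^{GL}` over the field `F = GF(p)` to … `g = f^k`")] -/
def blkG (f : (Fin n → Bool) → Bool) (b : Blk n k β) : ZMod p :=
  dpGLP f (b.1, fun i => ((posVal (b.2 i) : ℕ) : ZMod p))

variable (p) in
/-- **`AMP_p(f) = h^{vN}`**: von Neumann's trick applied to the `2T` Goldreich–Levin symbols of the
blocks. [cite: CarmosinoImpagliazzoKabanetsKolokolova2016, §4.2 (definition of `h^{vN}`), Thm. 4.8] -/
def ampP (f : (Fin n → Bool) → Bool) (k β T : ℕ) (w : AmpPIdx n k β T → Bool) : Bool :=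
  vnE2 T fun c => blkG p f (blkOf w c)

/-! ### The ideal blocks and their encoding as valid bit blocks -/

/-- The junk range `B = ⌊2^β/p⌋`. [cite: CarmosinoImpagliazzoKabanetsKolokolova2016, footnote 5] -/
def jB (p β : ℕ) : ℕ := 2 ^ β / p

omit hp in
/-- `B·p ≤ 2^β`. [folklore] -/
theorem jB_mul_le : jB p β * p ≤ 2 ^ β := Nat.div_mul_le_self _ _

/-- `2^β < B·p + p`. [folklore] -/
theorem lt_jB_mul_add : 2 ^ β < jB p β * p + p := Nat.lt_div_mul_add hp.out.pos

/-- `B > 0` once `2^β ≥ p`. [folklore] -/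
theorem jB_pos (hβ : p ≤ 2 ^ β) : 0 < jB p β := Nat.div_pos hβ hp.out.pos

/-- A point together with the junk quotient of a valid position. [folklore] -/
abbrev UJ (n p β : ℕ) : Type := (Fin n → Bool) × Fin (jB p β)

/-- An ideal block: `k` (point, junk) pairs and `k` field positions. [folklore] -/
abbrev SBlk (n k p β : ℕ) : Type := (Fin k → UJ n p β) × FVec p k

/-- The numeric value `r + p·q < Bp ≤ 2^β` of a valid position. [cite: CarmosinoImpagliazzoKabanetsKolokolova2016, footnote 5] -/
def encPosN (q : Fin (jB p β)) (r : ZMod p) : ℕ := r.val + p * q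

/-- A valid position value is below `2^β`. [folklore] -/
theorem encPosN_lt (q : Fin (jB p β)) (r : ZMod p) : encPosN q r < 2 ^ β := by
  unfold encPosN
  have hq : (q : ℕ) + 1 ≤ jB p β := q.isLt
  have hr : r.val < p := r.val_lt
  calc r.val + p * q < p + p * q := by omega
    _ = p * (q + 1) := by ring
    _ ≤ p * jB p β := Nat.mul_le_mul_left p hq
    _ ≤ 2 ^ β := by rw [mul_comm]; exact jB_mul_le

/-- The bits of a valid position. [folklore] -/
def encPos (q : Fin (jB p β)) (r : ZMod p) : Fin β → Bool :=
  (boolFunEquivFin β).symm ⟨encPosN q r, encPosN_lt q r⟩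

/-- The value of the encoded position. [folklore] -/
theorem posVal_encPos (q : Fin (jB p β)) (r : ZMod p) : posVal (encPos q r) = encPosN q r := by
  simp [posVal, encPos]

/-- The encoded position reduces to `r` mod `p`. [folklore] -/
theorem cast_posVal_encPos (q : Fin (jB p β)) (r : ZMod p) : ((posVal (encPos q r) : ℕ) : ZMod p) = r := by
  rw [posVal_encPos, encPosN, Nat.cast_add, Nat.cast_mul, ZMod.natCast_self, zero_mul, add_zero,
    ZMod.natCast_zmod_val]

/-- The position encoding is injective. [folklore] -/
theorem encPos_injective2 {q q' : Fin (jB p β)} {r r' : ZMod p} (h : encPos q r = encPos q' r') : q = q' ∧ r = r' := by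
  have hN : encPosN q r = encPosN q' r' := by rw [← posVal_encPos, ← posVal_encPos, h]
  have hr : r = r' := by rw [← cast_posVal_encPos q r, ← cast_posVal_encPos q' r', h]
  subst hr
  refine ⟨Fin.ext ?_, rfl⟩
  unfold encPosN at hN
  have := hp.out.pos
  have h2 : p * (q : ℕ) = p * q' := by omega
  exact Nat.eq_of_mul_eq_mul_left this h2

/-- The encoding of an ideal block as a (valid) bit block. [folklore] -/
def encBlk (σ : SBlk n k p β) : Blk n k β := (fun i => (σ.1 i).1, fun i => encPos (σ.1 i).2 (σ.2 i))

/-- The block encoding is injective. [folklore] -/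
theorem encBlk_injective : Injective (encBlk (n := n) (k := k) (p := p) (β := β)) := by
  intro σ τ h
  have h1 := congrArg Prod.fst h
  have h2 := congrArg Prod.snd h
  simp only [encBlk] at h1 h2
  have hq : ∀ i, (σ.1 i).2 = (τ.1 i).2 ∧ σ.2 i = τ.2 i := fun i => encPos_injective2 (congrFun h2 i)
  refine Prod.ext (funext fun i => Prod.ext (congrFun h1 i) (hq i).1) (funext fun i => (hq i).2)

/-- **On an encoded block the symbol is the `𝔽_p`-GL symbol of `f' = f ∘ fst`.** [cite: CarmosinoImpagliazzoKabanetsKolokolova2016, §4.2] -/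
theorem blkG_encBlk (f : (Fin n → Bool) → Bool) (σ : SBlk n k p β) :
    blkG p f (encBlk σ) = dpGLP (fun u : UJ n p β => f u.1) σ := by
  unfold blkG dpGLP encBlk
  simp only [cast_posVal_encPos]
  rfl

/-- The encoding of a tuple of ideal blocks as an input. [folklore] -/
def encode (w : Fin (T * 2) → SBlk n k p β) : AmpPIdx n k β T → Bool :=
  (ampPEquiv n k β T).symm fun c => encBlk (w c)

/-- The input encoding is injective. [folklore] -/
theorem encode_injective : Injective (encode (n := n) (k := k) (p := p) (β := β) (T := T)) := by
  intro w w' h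
  have h' := congrArg (ampPEquiv n k β T) h
  simp only [encode, Equiv.apply_symm_apply] at h'
  funext c
  exact encBlk_injective (congrFun h' c)

/-- The blocks of an encoded input. [folklore] -/
theorem blkOf_encode (w : Fin (T * 2) → SBlk n k p β) (c : Fin (T * 2)) : blkOf (encode w) c = encBlk (w c) := by
  have h : blkOf (encode w) = fun c => encBlk (w c) := by
    rw [← ampPEquiv_apply, encode, Equiv.apply_symm_apply]
  exact congrFun h c

/-- **`AMP_p(f)` on an encoded input is `E^{vN}` of the ideal labels.** [cite: CarmosinoImpagliazzoKabanetsKolokolova2016, §4.2 (definition of `h^{vN}`)] -/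
theorem ampP_encode (f : (Fin n → Bool) → Bool) (w : Fin (T * 2) → SBlk n k p β) :
    ampP p f k β T (encode w) = vnE2 T (realLab (dpGLP fun u : UJ n p β => f u.1) w) := by
  unfold ampP realLab
  congr 1
  funext c
  rw [blkOf_encode, blkG_encBlk]

/-! ### Transfer of agreement to the ideal model -/

/-- **Agreement transfers along the encoding up to the invalid inputs.** [folklore] -/
theorem card_agree_encode_ge (h₁ : (AmpPIdx n k β T → Bool) → Bool) (f : (Fin n → Bool) → Bool) :
    ((univ.filter fun v : AmpPIdx n k β T → Bool => h₁ v = ampP p f k β T v).card : ℝ) -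
        (Fintype.card (AmpPIdx n k β T → Bool) - Fintype.card (Fin (T * 2) → SBlk n k p β)) ≤
      ((univ.filter fun w : Fin (T * 2) → SBlk n k p β =>
        h₁ (encode w) = vnE2 T (realLab (dpGLP fun u : UJ n p β => f u.1) w)).card : ℝ) := by
  classical
  set img : Finset (AmpPIdx n k β T → Bool) :=
    univ.map (⟨encode, encode_injective⟩ : (Fin (T * 2) → SBlk n k p β) ↪ (AmpPIdx n k β T → Bool)) with himg
  have hcard_img : img.card = Fintype.card (Fin (T * 2) → SBlk n k p β) := by
    rw [himg, card_map, card_univ]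
  -- split the agreeing inputs into encoded and non-encoded ones
  have hsplit := Finset.card_filter_add_card_filter_not (s := univ.filter fun v : AmpPIdx n k β T → Bool =>
    h₁ v = ampP p f k β T v) (fun v => v ∈ img)
  rw [filter_filter, filter_filter] at hsplit
  have hin : (univ.filter fun v : AmpPIdx n k β T → Bool => (h₁ v = ampP p f k β T v) ∧ v ∈ img).card =
      (univ.filter fun w : Fin (T * 2) → SBlk n k p β =>
        h₁ (encode w) = vnE2 T (realLab (dpGLP fun u : UJ n p β => f u.1) w)).card := by
    symm
    refine Finset.card_bij (fun w _ => encode w) ?_ ?_ ?_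
    · intro w hw
      have hw' := (mem_filter.1 hw).2
      refine mem_filter.2 ⟨mem_univ _, ?_, ?_⟩
      · rw [ampP_encode]; exact hw'
      · rw [himg]; exact mem_map.2 ⟨w, mem_univ _, rfl⟩
    · intro w _ w' _ h; exact encode_injective h
    · intro v hv
      obtain ⟨hagree, hmem⟩ := (mem_filter.1 hv).2
      rw [himg, mem_map] at hmem
      obtain ⟨w, -, rfl⟩ := hmem
      refine ⟨w, mem_filter.2 ⟨mem_univ _, ?_⟩, rfl⟩
      rw [← ampP_encode]; exact hagree
  have hout : (univ.filter fun v : AmpPIdx n k β T → Bool => (h₁ v = ampP p f k β T v) ∧ ¬ v ∈ img).card ≤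
      Fintype.card (AmpPIdx n k β T → Bool) - img.card := by
    calc (univ.filter fun v : AmpPIdx n k β T → Bool => (h₁ v = ampP p f k β T v) ∧ ¬ v ∈ img).card
        ≤ (univ.filter fun v : AmpPIdx n k β T → Bool => ¬ v ∈ img).card :=
          card_le_card (fun v hv => mem_filter.2 ⟨mem_univ _, (mem_filter.1 hv).2.2⟩)
      _ = Fintype.card (AmpPIdx n k β T → Bool) - img.card := by
          have h := Finset.card_filter_add_card_filter_not (s := (univ : Finset (AmpPIdx n k β T → Bool))) (fun v => v ∈ img)
          rw [Finset.filter_mem_eq_inter, univ_inter, card_univ] at h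
          omega
  have himg_le : img.card ≤ Fintype.card (AmpPIdx n k β T → Bool) := by
    rw [← card_univ]; exact card_le_card (subset_univ _)
  rw [← hcard_img]
  have e : ((univ.filter fun v : AmpPIdx n k β T → Bool => h₁ v = ampP p f k β T v).card : ℝ) =
      ((univ.filter fun w : Fin (T * 2) → SBlk n k p β =>
        h₁ (encode w) = vnE2 T (realLab (dpGLP fun u : UJ n p β => f u.1) w)).card : ℝ) +
      ((univ.filter fun v : AmpPIdx n k β T → Bool => (h₁ v = ampP p f k β T v) ∧ ¬ v ∈ img).card : ℝ) := by
    rw [← hin]; exact_mod_cast hsplit.symm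
  rw [e]
  have hout' : ((univ.filter fun v : AmpPIdx n k β T → Bool => (h₁ v = ampP p f k β T v) ∧ ¬ v ∈ img).card : ℝ) ≤
      (Fintype.card (AmpPIdx n k β T → Bool) : ℝ) - img.card := by
    have := (Nat.cast_le (α := ℝ)).2 hout
    rw [Nat.cast_sub himg_le] at this
    exact this
  linarith

/-! ### The valid inputs are almost all inputs -/

omit hp in
/-- The number of inputs of `AMP_p(f)`. [folklore] -/
theorem card_ampPInputs : Fintype.card (AmpPIdx n k β T → Bool) = 2 ^ (T * 2 * (k * n + k * β)) := by
  simp only [Fintype.card_fun, Fintype.card_bool, Fintype.card_prod, Fintype.card_sum, Fintype.card_fin]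

/-- The number of ideal blocks. [folklore] -/
theorem card_SBlk : Fintype.card (SBlk n k p β) = (2 ^ n * jB p β) ^ k * p ^ k := by
  simp only [SBlk, UJ, FVec, Fintype.card_prod, Fintype.card_fun, Fintype.card_bool, Fintype.card_fin, ZMod.card]

/-- The number of ideal inputs. [folklore] -/
theorem card_ideal : Fintype.card (Fin (T * 2) → SBlk n k p β) = ((2 ^ n * jB p β) ^ k * p ^ k) ^ (T * 2) := by
  rw [Fintype.card_fun, Fintype.card_fin, card_SBlk]

/-- **The encoded (valid) inputs are at least a `1 - 2Tkp/2^β` fraction of all inputs** (each of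
the `2Tk` positions is invalid with probability `< p/2^β`; Bernoulli).
[cite: CarmosinoImpagliazzoKabanetsKolokolova2016, footnote 5 ("the statistical difference … is at most `p/2^k`")] -/
theorem card_ideal_ge (hβ : p ≤ 2 ^ β) :
    (1 - (T * 2 : ℕ) * k * p / (2 : ℝ) ^ β) * Fintype.card (AmpPIdx n k β T → Bool) ≤
      Fintype.card (Fin (T * 2) → SBlk n k p β) := by
  rw [card_ampPInputs, card_ideal]
  push_cast
  have h2β : (0 : ℝ) < (2 : ℝ) ^ β := by positivity
  have hpR : (0 : ℝ) < p := by exact_mod_cast hp.out.pos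
  -- `jB · p ≥ 2^β - p`, i.e. `jB p / 2^β ≥ 1 - p/2^β`
  have hjB : (2 : ℝ) ^ β * (1 - p / (2 : ℝ) ^ β) ≤ (jB p β : ℝ) * p := by
    have h := lt_jB_mul_add (p := p) (β := β)
    have h' : ((2 ^ β : ℕ) : ℝ) < ((jB p β * p + p : ℕ) : ℝ) := by exact_mod_cast h
    push_cast at h'
    rw [mul_sub, mul_one, mul_div_cancel₀ _ h2β.ne']
    linarith
  have hx : (-2 : ℝ) ≤ -(p / (2 : ℝ) ^ β) := by
    have : (p : ℝ) / (2 : ℝ) ^ β ≤ 1 := by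
      rw [div_le_one h2β]; exact_mod_cast hβ
    linarith
  have hbern := one_add_mul_le_pow hx (k * (T * 2))
  -- rewrite the right-hand side as `(2^n)^{k·2T} · (jB·p)^{k·2T}`
  have hR : ((((2 : ℝ) ^ n * jB p β) ^ k * (p : ℝ) ^ k) ^ (T * 2)) =
      ((2 : ℝ) ^ n) ^ (k * (T * 2)) * ((jB p β : ℝ) * p) ^ (k * (T * 2)) := by
    rw [show ((2 : ℝ) ^ n * jB p β) ^ k * (p : ℝ) ^ k = ((2 : ℝ) ^ n) ^ k * ((jB p β : ℝ) * p) ^ k by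
      rw [mul_pow, mul_pow]; ring, mul_pow, ← pow_mul, ← pow_mul]
    ring
  have hL : (2 : ℝ) ^ (T * 2 * (k * n + k * β)) = ((2 : ℝ) ^ n) ^ (k * (T * 2)) * ((2 : ℝ) ^ β) ^ (k * (T * 2)) := by
    rw [← pow_mul, ← pow_mul, ← pow_add]; ring_nf
  rw [hR, hL]
  have hle1 : (p : ℝ) / (2 : ℝ) ^ β ≤ 1 := by rw [div_le_one h2β]; exact_mod_cast hβ
  have h1 : (0 : ℝ) ≤ 1 - p / (2 : ℝ) ^ β := by linarith
  have hpow : ((2 : ℝ) ^ β) ^ (k * (T * 2)) * (1 - p / (2 : ℝ) ^ β) ^ (k * (T * 2)) ≤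
      ((jB p β : ℝ) * p) ^ (k * (T * 2)) := by
    rw [← mul_pow]; exact pow_le_pow_left₀ (by positivity) hjB _
  have hA : (0 : ℝ) ≤ ((2 : ℝ) ^ n) ^ (k * (T * 2)) := by positivity
  calc (1 - (T : ℝ) * 2 * k * p / (2 : ℝ) ^ β) * (((2 : ℝ) ^ n) ^ (k * (T * 2)) * ((2 : ℝ) ^ β) ^ (k * (T * 2)))
      = ((2 : ℝ) ^ n) ^ (k * (T * 2)) * (((2 : ℝ) ^ β) ^ (k * (T * 2)) * (1 + (k * (T * 2) : ℕ) * -(p / (2 : ℝ) ^ β))) := by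
        push_cast; ring
    _ ≤ ((2 : ℝ) ^ n) ^ (k * (T * 2)) * (((2 : ℝ) ^ β) ^ (k * (T * 2)) * (1 + -(p / (2 : ℝ) ^ β)) ^ (k * (T * 2))) := by
        gcongr
    _ = ((2 : ℝ) ^ n) ^ (k * (T * 2)) * (((2 : ℝ) ^ β) ^ (k * (T * 2)) * (1 - p / (2 : ℝ) ^ β) ^ (k * (T * 2))) := by
        ring
    _ ≤ ((2 : ℝ) ^ n) ^ (k * (T * 2)) * ((jB p β : ℝ) * p) ^ (k * (T * 2)) := by
        gcongr

/-- **Agreement with `AMP_p(f)` gives agreement in the ideal model**: if `h₁` agrees with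
`AMP_p(f)` on a `1/2 + η₀` fraction of all inputs (`η₀ ≥ 0`) and `ν = 2Tkp/2^β ≤ 1/2`, then in
the ideal model `h₁ ∘ encode` agrees with `E^{vN}` of the real labels on a `1/2 + (η₀ - 2ν)`
fraction. [cite: CarmosinoImpagliazzoKabanetsKolokolova2016, Thm. 4.7/4.8 (with footnote 5)] -/
theorem ideal_agreement_ge (hβ : p ≤ 2 ^ β) (h₁ : (AmpPIdx n k β T → Bool) → Bool) (f : (Fin n → Bool) → Bool)
    {η₀ : ℝ} (hη₀ : 0 ≤ η₀) (hν : (T * 2 : ℕ) * k * p / (2 : ℝ) ^ β ≤ 1 / 2)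
    (hA : (1 / 2 + η₀) * Fintype.card (AmpPIdx n k β T → Bool) ≤
      ((univ.filter fun v : AmpPIdx n k β T → Bool => h₁ v = ampP p f k β T v).card : ℝ)) :
    (1 / 2 + (η₀ - 2 * ((T * 2 : ℕ) * k * p / (2 : ℝ) ^ β))) * Fintype.card (Fin (T * 2) → SBlk n k p β) ≤
      ((univ.filter fun w : Fin (T * 2) → SBlk n k p β =>
        h₁ (encode w) = vnE2 T (realLab (dpGLP fun u : UJ n p β => f u.1) w)).card : ℝ) := by
  set ν : ℝ := (T * 2 : ℕ) * k * p / (2 : ℝ) ^ β with hνdef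
  set M : ℝ := (Fintype.card (AmpPIdx n k β T → Bool) : ℝ) with hM
  set V : ℝ := (Fintype.card (Fin (T * 2) → SBlk n k p β) : ℝ) with hV
  have hν0 : 0 ≤ ν := by rw [hνdef]; positivity
  have htr := card_agree_encode_ge (p := p) h₁ f (n := n) (k := k) (β := β) (T := T)
  have hVM : (1 - ν) * M ≤ V := card_ideal_ge hβ
  have hVle : V ≤ M := by
    rw [hV, hM]
    exact_mod_cast Fintype.card_le_of_injective _ encode_injective
  have hM0 : 0 < M := by rw [hM]; exact_mod_cast Fintype.card_pos
  have hagree_le : ((univ.filter fun v : AmpPIdx n k β T → Bool => h₁ v = ampP p f k β T v).card : ℝ) ≤ M := by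
    rw [hM]; exact_mod_cast (card_filter_le _ _).trans_eq card_univ
  have hη' : η₀ ≤ 1 / 2 := by nlinarith
  set A : ℝ := ((univ.filter fun v : AmpPIdx n k β T → Bool => h₁ v = ampP p f k β T v).card : ℝ) with hAdef
  set W : ℝ := ((univ.filter fun w : Fin (T * 2) → SBlk n k p β =>
        h₁ (encode w) = vnE2 T (realLab (dpGLP fun u : UJ n p β => f u.1) w)).card : ℝ) with hWdef
  -- `W ≥ A - (M - V) ≥ V - (1/2 - η₀) M` and `(1/2 - η₀ + 2ν) V ≥ (1/2 - η₀) M`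
  have h1 : V - (1 / 2 - η₀) * M ≤ W := by linarith
  have h2 : (1 / 2 - η₀) * M ≤ (1 / 2 - η₀ + 2 * ν) * V := by
    have h3 : (1 / 2 - η₀ + 2 * ν) * ((1 - ν) * M) ≤ (1 / 2 - η₀ + 2 * ν) * V :=
      mul_le_mul_of_nonneg_left hVM (by linarith)
    nlinarith
  nlinarith

/-! ### `AMP_p(f)` on enumerated bits -/

/-- The bit positions of `AMP_p(f)` enumerated by `Fin (2T(kn + kβ))` (block by block; in a block
the `k` points first, then the `k` positions). [folklore] -/
def ampPIdxEquiv (n k β T : ℕ) : AmpPIdx n k β T ≃ Fin (T * 2 * (k * n + k * β)) :=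
  (Equiv.prodCongr (Equiv.refl (Fin (T * 2)))
    ((finProdFinEquiv.sumCongr finProdFinEquiv).trans finSumFinEquiv)).trans finProdFinEquiv

variable (p) in
/-- `AMP_p(f)` as a function of `2T(kn + kβ)` enumerated bits. [cite: CarmosinoImpagliazzoKabanetsKolokolova2016, Thm. 3.2 (proof: "`f* = AMP(f)`")] -/
def ampPFin (f : (Fin n → Bool) → Bool) (k β T : ℕ) : (Fin (T * 2 * (k * n + k * β)) → Bool) → Bool :=
  fun v => ampP p f k β T (v ∘ ampPIdxEquiv n k β T)

/-- `f' = f ∘ fst` on points with junk. [folklore] -/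
def fJ (f : (Fin n → Bool) → Bool) : UJ n p β → Bool := fun u => f u.1

/-- The agreement of `h₁` with `AMP_p(f)` on enumerated bits, as a count over `AmpPIdx`-indexed
inputs. [folklore] -/
theorem card_agree_ampPFin (h₁ : (Fin (T * 2 * (k * n + k * β)) → Bool) → Bool) (f : (Fin n → Bool) → Bool) :
    ((univ.filter fun v : Fin (T * 2 * (k * n + k * β)) → Bool => h₁ v = ampPFin p f k β T v).card) =
      (univ.filter fun u : AmpPIdx n k β T → Bool =>
        h₁ (u ∘ (ampPIdxEquiv n k β T).symm) = ampP p f k β T u).card := by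
  rw [← card_filter_comp_equiv (Equiv.arrowCongr (ampPIdxEquiv n k β T) (Equiv.refl Bool))
    (fun v : Fin (T * 2 * (k * n + k * β)) → Bool => h₁ v = ampPFin p f k β T v)]
  congr 1
  ext u
  simp only [mem_filter, mem_univ, true_and, ampPFin]
  have h1 : (Equiv.arrowCongr (ampPIdxEquiv n k β T) (Equiv.refl Bool)) u = u ∘ (ampPIdxEquiv n k β T).symm := rfl
  have h2 : (u ∘ (ampPIdxEquiv n k β T).symm) ∘ (ampPIdxEquiv n k β T) = u := by
    funext i; simp
  rw [h1, h2]


end Literature.Computability.Learning
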